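/-
Copyright (c) 2026 the pub-hodgecm-mathlib formalisation cell (harness21).  Prover seat hodgecm-mathlib-LH4-p08 (g7), req620 Track A «(D-RAM) FOUR-FRAME» squad, helper lane
on h413 = stmt-HodgeConjecture-24833 (count-neutral).  STAGE-1b typed inventory (heir LEAD F0P3a-plan (g20) T19-24): ROW (3) G-SIDE OF THE LEVELS PIECES — EXACT LAW.  2026-09-04.
-/
import Summits.HodgeConjecture.HodgeConjecture.Theorems.F0P3cDyRamPieceRegLeviRow           -- ★ p859150 (this seat): `measureReal_setOf_mem_cmLocalIntegralLevel_ne_zero`; brings ★ p858969 (`integral_gselStar_zero_eq_measureReal`), ★ p858649, ★ p859102, ★ p855650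
import Summits.HodgeConjecture.HodgeConjecture.Theorems.F0P3cDyRamLevelsPieceCountDictionary -- ★ p858704 (LH4-p06 (g6)): `indicator_levels_conj_eq`, `isLocSmooth_indicator_levels`; brings ★ `indicator_profile_level_mul_eq`, ★ `inLevel_add_iff_of_inLevel`, ★ `inLevel_mul_self_add_iff`, ★ `uniformizer_facts`
import HarnessLib

/-!
# Crux `H413`, line LH4 «(D-RAM) FOUR-FRAME» — ROW (3) `G`-SIDE OF THE CONGRUENCE-PROFILE PIECES `𝟙_{K_{a,b}}`, EXACT: near `1` on the Levi population
# `Σᶠ_c Δ‴_v[μ](γ_H, out c)·Φ(c, 𝟙_{K_{a,b}}) = q_v^{−e(a,b,d)} · (νG₃(K)∕νH(K_H)) · Φ^st(γ_H, hFamily 0)`,  `e(a,b,d) = (max (max a ⌈b∕2⌉) ⌊(a+d)∕2⌋ − ⌊d∕2⌋) + ⌈(a − d%2)∕2⌉`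

Cell `hodgecm-mathlib` (D-0151), FLOOR 0, crux item H413 = `stmt-HodgeConjecture-24833`, route of record `HCCMUnconditional`; squad F0∕P3c∕LH4 (req618∕req620); helper lane
`--supports stmt-HodgeConjecture-24833 --as helper` (count-neutral).  THEOREMS ONLY (no `def`, no instance, no notation, no `sorry`, default heartbeats except one statement-heavy `N`-integral).

WHAT.  After ★ p858649 (linearity: `f_{T−} = shell − f_{T+}`, `shell = 𝟙_{K_{ℓ₀,m*}} − 𝟙_{K_{ℓ₀+1,m*}}`, `f_reg = 1_K − 𝟙_{K_{·,m*}²}`) the unlabelled STAGE-1b pieces are the congruence-profile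
pieces `𝟙_{K_{a,b}} = 𝟙{u ∈ K ∣ ι_w u − 1 ∈ ϖ^a M₃, (ι_w u − 1)² ∈ ϖ^b M₃}` (★ p858704 set-builder).  This file gives the EXACT row-(3) `G`-side of every such piece with `a, b ≤ m*`: the
generic near-1 Levi proportionality ★ p858898 (`Ad K`-invariance ★ `indicator_levels_conj_eq`; left-`K(ϖ_w^{m*})`-invariance by ★ `indicator_profile_level_mul_eq` with ★
`inLevel_add_iff_of_inLevel` ∕ `inLevel_mul_self_add_iff`) against the anchor `1_K = gselStar 0` (★ `piecePropsWild_gselStar`), the anchor's row (3) ★ p855650 at the root vertex,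
`∫_N 1_K = μ_N{n ∈ K}` (★ p858969 §1), the LEVELS FIBRE VOLUME of LH4-p10 (g5) ★ p859102 `measureReal_setOf_mem_and_levels_eq`
(`μ_N{n ∈ K, lev_{a,b}} = q_v^{−e(a,b,d)}·μ_N{n ∈ K}`), and cancellation of `μ_N{n ∈ K} ≠ 0` (★ p859150).  Instances of record (the consumer plugs them): `(ℓ₀, m*)`, `(ℓ₀+1, m*)`
(the shell, rows T±) and `(0, m*)` (the square-level piece, row reg — cf. ★ p859150's complement form).

* `integral_indicator_levels_eq` — `∫_N 𝟙_{K_{a,b}}(n) dμ_N = μ_N.real{n ∈ K, lev_{a,b}}` (★ p859102's set TOKEN FOR TOKEN).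
* `exists_nhds_one_finsum_delta_levels_eq_of_levi` — THE EXACT LAW above.
HONEST LABEL.  Count-neutral (`--supports`): composition BY NAME over ★ only; pays no registered stub and touches no `Lines/` module; the three tier-0 rows stay OPEN;
`HC_CM` is proved only modulo the 7 printed citations (2 remaining named inputs: hLiu418 = `stmt-HodgeConjecture-24832`, h413 = `stmt-HodgeConjecture-24833`) until rung 0 closes.

## References
* [Rogawski1990] J. D. Rogawski, *Automorphic Representations of Unitary Groups in Three Variables*, Ann. of Math. Stud. 123 (1990): §4.9 Prop. 4.9.1 (b) p. 55, Lemma 4.9.2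
  p. 56; §4.3 (4.3.1) p. 43; §3.5 Prop. 3.5.2 pp. 25–26.
* [Kottwitz1986BaseChangeUnits] R. E. Kottwitz, *Base change for unit elements of Hecke algebras*, Compositio Math. 60 (1986), §1 pp. 240–241.
* [Serre1979] J.-P. Serre, *Local Fields*, GTM 67 (1979), Ch. IV §1 Prop. 4.
-/

set_option autoImplicit false

noncomputable section

namespace Summit.HodgeConjecture.HodgeConjecture.Cruxes.H413.F0P3cDyRamLevelsLeviRow

open MeasureTheory Measure NumberField IsDedekindDomain Topology Filter
open Literature.NumberTheory.Automorphic Literature.NumberTheory.Automorphic.UnitaryGroup Literature.NumberTheory.Automorphic.IntegralReduction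
open Literature.NumberTheory.Automorphic.UnitaryLatticeTree Literature.NumberTheory.Automorphic.HermitianLattice
open Literature.NumberTheory.Automorphic.UnitaryThreeFourFrame
open Literature.NumberTheory.Rogawski1990 Literature.NumberTheory.GaloisRepresentations
open scoped Matrix MatrixGroups Classical ValuativeRel WithZero
open Summit.HodgeConjecture.HodgeConjecture.Cruxes.H413.F0P3cDyRamFourFramePieces
open Summit.HodgeConjecture.HodgeConjecture.Cruxes.H413.F0P3cDyRamFourFrameHFamilyDefs
open Summit.HodgeConjecture.HodgeConjecture.Cruxes.H413.F0P3cDyRamProfileLevelClass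
open Summit.HodgeConjecture.HodgeConjecture.Cruxes.H413.F0P3cDyRamProfilePiecesProps
open Summit.HodgeConjecture.HodgeConjecture.Cruxes.H413.F0P3cDyRamLevelsPieceCountDictionary
open Summit.HodgeConjecture.HodgeConjecture.Cruxes.H413.F0P3cDyRamPiecePropsGselStar
open Summit.HodgeConjecture.HodgeConjecture.Cruxes.H413.F0P3cDyRamPieceLeviRow
open Summit.HodgeConjecture.HodgeConjecture.Cruxes.H413.F0P3cDyRamPieceRegLeviRow
open Summit.HodgeConjecture.HodgeConjecture.Cruxes.H413.F0P3cDyRamAnchorLeviClause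
open Summit.HodgeConjecture.HodgeConjecture.Cruxes.H413.F0P3cDyRamDOfPlaceOfDatum

/-! ## §1  The levels piece's unipotent-fibre volume -/

set_option maxHeartbeats 800000 in
-- statement-heavy: the `N`-set-builder of ★ p859102 on the CM carriers and the `InLevel ∕ wMatrix` ↔ place-matrix identification (`rfl` after `simp only`)
/-- **`∫_N 𝟙_{K_{a,b}}(n) dμ_N = μ_N.real{n ∈ K : n_w − 1 ∈ ϖ^a M₃, (n_w − 1)² ∈ ϖ^b M₃}`** (★ p859102's levels set token for token; it is closed, hence Borel, and contained in
the compact `{n ∈ K}`). [cite: Rogawski1990, §4.9 Prop. 4.9.1 (b) p. 55] [cite: Kottwitz1986BaseChangeUnits, §1 pp. 240–241] -/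
theorem integral_indicator_levels_eq
    (L : Type) [Field L] [NumberField L] [IsCMField L]
    {v : HeightOneSpectrum (𝓞 ↥(maximalRealSubfield L))} (w : UnitaryGroup.PlacesOver L v)
    (hw : IsCMField.complexConj L • w.1 = w.1) (ϖ : w.1.adicCompletion L) (hϖ : Valued.v ϖ = WithZero.exp (-1 : ℤ)) (a b : ℕ)
    [MeasurableSpace ↥(unitaryGroupOfForm (conjLocal L (IsCMField.complexConj L) v) (cmLocalForm L 3 v))] [BorelSpace ↥(unitaryGroupOfForm (conjLocal L (IsCMField.complexConj L) v) (cmLocalForm L 3 v))]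
    (μN : Measure ↥(unipotentU (conjLocal L (IsCMField.complexConj L) v) (cmLocalForm L 3 v))) [μN.IsHaarMeasure] :
    ∫ n : ↥(unipotentU (conjLocal L (IsCMField.complexConj L) v) (cmLocalForm L 3 v)), Set.indicator {u : ((cmDatum L 3 (Matrix.of fun i j : Fin 3 => if i.val + j.val + 1 = 3 then (1 : L) else 0)).Local v) |
          u ∈ cmLocalIntegralLevel L 3 (Matrix.of fun i j : Fin 3 => if i.val + j.val + 1 = 3 then (1 : L) else 0) v ∧
          (InLevel ϖ a (wMatrix L w hw u - 1) ∧ InLevel ϖ b ((wMatrix L w hw u - 1) * (wMatrix L w hw u - 1)))} (fun _ => (1 : ℂ)) ((n : ↥(unitaryGroupOfForm (conjLocal L (IsCMField.complexConj L) v) (cmLocalForm L 3 v))) : ((cmDatum L 3 (Matrix.of fun i j : Fin 3 => if i.val + j.val + 1 = 3 then (1 : L) else 0)).Local v)) ∂μN =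
      ((μN.real {n : ↥(unipotentU (conjLocal L (IsCMField.complexConj L) v) (cmLocalForm L 3 v)) | (n : ↥(unitaryGroupOfForm (conjLocal L (IsCMField.complexConj L) v) (cmLocalForm L 3 v))) ∈
            cmLocalIntegralLevel L 3 (Matrix.of fun i j : Fin 3 => if i.val + j.val + 1 = 3 then (1 : L) else 0) v ∧
          (∀ i j : Fin 3, Valued.v ((ϖ ^ a)⁻¹ *
            (((n : ↥(unitaryGroupOfForm (conjLocal L (IsCMField.complexConj L) v) (cmLocalForm L 3 v))) : GL (Fin 3) (LocalRing L v)).val.map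
                (Pi.evalRingHom (fun w' : PlacesOver L v => w'.1.adicCompletion L) w) - 1) i j) ≤ 1) ∧
          ∀ i j : Fin 3, Valued.v ((ϖ ^ b)⁻¹ *
            ((((n : ↥(unitaryGroupOfForm (conjLocal L (IsCMField.complexConj L) v) (cmLocalForm L 3 v))) : GL (Fin 3) (LocalRing L v)).val.map
                (Pi.evalRingHom (fun w' : PlacesOver L v => w'.1.adicCompletion L) w) - 1) *
             (((n : ↥(unitaryGroupOfForm (conjLocal L (IsCMField.complexConj L) v) (cmLocalForm L 3 v))) : GL (Fin 3) (LocalRing L v)).val.map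
                (Pi.evalRingHom (fun w' : PlacesOver L v => w'.1.adicCompletion L) w) - 1)) i j) ≤ 1} : ℝ) : ℂ) := by
  have hSlev : MeasurableSet {n : ↥(unipotentU (conjLocal L (IsCMField.complexConj L) v) (cmLocalForm L 3 v)) | (n : ↥(unitaryGroupOfForm (conjLocal L (IsCMField.complexConj L) v) (cmLocalForm L 3 v))) ∈
            cmLocalIntegralLevel L 3 (Matrix.of fun i j : Fin 3 => if i.val + j.val + 1 = 3 then (1 : L) else 0) v ∧
          (∀ i j : Fin 3, Valued.v ((ϖ ^ a)⁻¹ *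
            (((n : ↥(unitaryGroupOfForm (conjLocal L (IsCMField.complexConj L) v) (cmLocalForm L 3 v))) : GL (Fin 3) (LocalRing L v)).val.map
                (Pi.evalRingHom (fun w' : PlacesOver L v => w'.1.adicCompletion L) w) - 1) i j) ≤ 1) ∧
          ∀ i j : Fin 3, Valued.v ((ϖ ^ b)⁻¹ *
            ((((n : ↥(unitaryGroupOfForm (conjLocal L (IsCMField.complexConj L) v) (cmLocalForm L 3 v))) : GL (Fin 3) (LocalRing L v)).val.map
                (Pi.evalRingHom (fun w' : PlacesOver L v => w'.1.adicCompletion L) w) - 1) *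
             (((n : ↥(unitaryGroupOfForm (conjLocal L (IsCMField.complexConj L) v) (cmLocalForm L 3 v))) : GL (Fin 3) (LocalRing L v)).val.map
                (Pi.evalRingHom (fun w' : PlacesOver L v => w'.1.adicCompletion L) w) - 1)) i j) ≤ 1} := (isClosed_setOf_mem_and_levels L v w hw hϖ a b).measurableSet
  have hpre : (fun n : ↥(unipotentU (conjLocal L (IsCMField.complexConj L) v) (cmLocalForm L 3 v)) => ((n : ↥(unitaryGroupOfForm (conjLocal L (IsCMField.complexConj L) v) (cmLocalForm L 3 v))) : ((cmDatum L 3 (Matrix.of fun i j : Fin 3 => if i.val + j.val + 1 = 3 then (1 : L) else 0)).Local v))) ⁻¹' {u : ((cmDatum L 3 (Matrix.of fun i j : Fin 3 => if i.val + j.val + 1 = 3 then (1 : L) else 0)).Local v) |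
          u ∈ cmLocalIntegralLevel L 3 (Matrix.of fun i j : Fin 3 => if i.val + j.val + 1 = 3 then (1 : L) else 0) v ∧
          (InLevel ϖ a (wMatrix L w hw u - 1) ∧ InLevel ϖ b ((wMatrix L w hw u - 1) * (wMatrix L w hw u - 1)))} = {n : ↥(unipotentU (conjLocal L (IsCMField.complexConj L) v) (cmLocalForm L 3 v)) | (n : ↥(unitaryGroupOfForm (conjLocal L (IsCMField.complexConj L) v) (cmLocalForm L 3 v))) ∈
            cmLocalIntegralLevel L 3 (Matrix.of fun i j : Fin 3 => if i.val + j.val + 1 = 3 then (1 : L) else 0) v ∧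
          (∀ i j : Fin 3, Valued.v ((ϖ ^ a)⁻¹ *
            (((n : ↥(unitaryGroupOfForm (conjLocal L (IsCMField.complexConj L) v) (cmLocalForm L 3 v))) : GL (Fin 3) (LocalRing L v)).val.map
                (Pi.evalRingHom (fun w' : PlacesOver L v => w'.1.adicCompletion L) w) - 1) i j) ≤ 1) ∧
          ∀ i j : Fin 3, Valued.v ((ϖ ^ b)⁻¹ *
            ((((n : ↥(unitaryGroupOfForm (conjLocal L (IsCMField.complexConj L) v) (cmLocalForm L 3 v))) : GL (Fin 3) (LocalRing L v)).val.map
                (Pi.evalRingHom (fun w' : PlacesOver L v => w'.1.adicCompletion L) w) - 1) *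
             (((n : ↥(unitaryGroupOfForm (conjLocal L (IsCMField.complexConj L) v) (cmLocalForm L 3 v))) : GL (Fin 3) (LocalRing L v)).val.map
                (Pi.evalRingHom (fun w' : PlacesOver L v => w'.1.adicCompletion L) w) - 1)) i j) ≤ 1} := by
    ext n
    simp only [Set.mem_preimage, Set.mem_setOf_eq, InLevel, wMatrix, coe_coe_localNonsplitEquiv_apply]
    rfl
  have e : (fun n : ↥(unipotentU (conjLocal L (IsCMField.complexConj L) v) (cmLocalForm L 3 v)) => Set.indicator {u : ((cmDatum L 3 (Matrix.of fun i j : Fin 3 => if i.val + j.val + 1 = 3 then (1 : L) else 0)).Local v) |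
          u ∈ cmLocalIntegralLevel L 3 (Matrix.of fun i j : Fin 3 => if i.val + j.val + 1 = 3 then (1 : L) else 0) v ∧
          (InLevel ϖ a (wMatrix L w hw u - 1) ∧ InLevel ϖ b ((wMatrix L w hw u - 1) * (wMatrix L w hw u - 1)))} (fun _ => (1 : ℂ)) ((n : ↥(unitaryGroupOfForm (conjLocal L (IsCMField.complexConj L) v) (cmLocalForm L 3 v))) : ((cmDatum L 3 (Matrix.of fun i j : Fin 3 => if i.val + j.val + 1 = 3 then (1 : L) else 0)).Local v))) = Set.indicator {n : ↥(unipotentU (conjLocal L (IsCMField.complexConj L) v) (cmLocalForm L 3 v)) | (n : ↥(unitaryGroupOfForm (conjLocal L (IsCMField.complexConj L) v) (cmLocalForm L 3 v))) ∈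
            cmLocalIntegralLevel L 3 (Matrix.of fun i j : Fin 3 => if i.val + j.val + 1 = 3 then (1 : L) else 0) v ∧
          (∀ i j : Fin 3, Valued.v ((ϖ ^ a)⁻¹ *
            (((n : ↥(unitaryGroupOfForm (conjLocal L (IsCMField.complexConj L) v) (cmLocalForm L 3 v))) : GL (Fin 3) (LocalRing L v)).val.map
                (Pi.evalRingHom (fun w' : PlacesOver L v => w'.1.adicCompletion L) w) - 1) i j) ≤ 1) ∧
          ∀ i j : Fin 3, Valued.v ((ϖ ^ b)⁻¹ *
            ((((n : ↥(unitaryGroupOfForm (conjLocal L (IsCMField.complexConj L) v) (cmLocalForm L 3 v))) : GL (Fin 3) (LocalRing L v)).val.map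
                (Pi.evalRingHom (fun w' : PlacesOver L v => w'.1.adicCompletion L) w) - 1) *
             (((n : ↥(unitaryGroupOfForm (conjLocal L (IsCMField.complexConj L) v) (cmLocalForm L 3 v))) : GL (Fin 3) (LocalRing L v)).val.map
                (Pi.evalRingHom (fun w' : PlacesOver L v => w'.1.adicCompletion L) w) - 1)) i j) ≤ 1} (fun _ => (1 : ℂ)) := by
    funext n
    rw [← hpre]
    exact (Set.indicator_comp_right (fun n : ↥(unipotentU (conjLocal L (IsCMField.complexConj L) v) (cmLocalForm L 3 v)) => ((n : ↥(unitaryGroupOfForm (conjLocal L (IsCMField.complexConj L) v) (cmLocalForm L 3 v))) : ((cmDatum L 3 (Matrix.of fun i j : Fin 3 => if i.val + j.val + 1 = 3 then (1 : L) else 0)).Local v)))).symm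
  rw [e, integral_indicator_const _ hSlev, Complex.real_smul, mul_one]

/-! ## §2  THE EXACT LAW: row (3)'s `G`-side of `𝟙_{K_{a,b}}` -/

set_option maxHeartbeats 800000 in
-- instance-term unification on the CM carriers (★ p858898's binder block)
/-- **ROW (3) `G`-SIDE OF `𝟙_{K_{a,b}}`, EXACT** (`a, b ≤ m* = mstarFn`).  At a wild ramified non-split CM place with datum `(ϖ, d, t_E)`, for the transfer factor of record `Δ‴_v[μ]`,
canonical families `mH`, `mG₃` (any Haar `νH`, `νG₃`) and any s-finite Haar `μ_N` on `N(L⁺_v)` (a witness — it cancels): there is `V ∈ 𝓝 (1 : H_v)` such that for every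
`G`-regular `γ_H ∈ V` which is `H_v`-conjugate to a diagonal,
`Σᶠ_c Δ‴(γ_H, out c)·Φ(c, 𝟙_{K_{a,b}}) = q_v^{−((max (max a ⌈b∕2⌉) ⌊(a+d)∕2⌋ − ⌊d∕2⌋) + ⌈(a − d%2)∕2⌉)} · (νG₃(K)∕νH(K_H)) · Φ^st(γ_H, hFamily 0)` (exponent = ★ p859102's, `ℕ`-divisions verbatim).
[cite: Rogawski1990, §4.9 Prop. 4.9.1 (b) p. 55, Lemma 4.9.2 p. 56; §4.3 (4.3.1) p. 43; §3.5 Prop. 3.5.2 pp. 25–26] [cite: Kottwitz1986BaseChangeUnits, §1 pp. 240–241] [cite: Serre1979, Ch. IV §1 Prop. 4] -/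
theorem exists_nhds_one_finsum_delta_levels_eq_of_levi
    (L : Type) [Field L] [NumberField L] [IsCMField L]
    {v : HeightOneSpectrum (𝓞 ↥(maximalRealSubfield L))} (w : UnitaryGroup.PlacesOver L v)
    (hw : IsCMField.complexConj L • w.1 = w.1)
    (he : v.asIdeal.ramificationIdx' w.1.asIdeal ≠ 1)
    (h2 : ¬ IsUnit (2 : 𝒪[w.1.adicCompletion L]))
    (ϖ : w.1.adicCompletion L) (hϖ : Valued.v ϖ = WithZero.exp (-1 : ℤ))
    (d tE : ℕ) (hD : IsRamifiedQuadraticDatum (galAdicCompletionMap (L := L) (IsCMField.complexConj L) hw) ϖ d tE)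
    (a b : ℕ) (ha : a ≤ mstarFn L v w) (hb : b ≤ mstarFn L v w)
    (μ : HeckeCharacter L)
    (hμω : ∀ x : ideleGroup ↥(maximalRealSubfield L), μ (AdeleRing.ideleBaseChange ↥(maximalRealSubfield L) L x) = quadraticHeckeCharCM L x)
    [MeasurableSpace ((cmDatum L 3 (Matrix.of fun i j : Fin 3 => if i.val + j.val + 1 = 3 then (1 : L) else 0)).Local v)]
    [BorelSpace ((cmDatum L 3 (Matrix.of fun i j : Fin 3 => if i.val + j.val + 1 = 3 then (1 : L) else 0)).Local v)]
    [∀ γ : ((cmDatum L 3 (Matrix.of fun i j : Fin 3 => if i.val + j.val + 1 = 3 then (1 : L) else 0)).Local v),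
      MeasurableSpace (((cmDatum L 3 (Matrix.of fun i j : Fin 3 => if i.val + j.val + 1 = 3 then (1 : L) else 0)).Local v) ⧸
        Subgroup.centralizer ({γ} : Set ((cmDatum L 3 (Matrix.of fun i j : Fin 3 => if i.val + j.val + 1 = 3 then (1 : L) else 0)).Local v)))]
    [∀ γ : ((cmDatum L 3 (Matrix.of fun i j : Fin 3 => if i.val + j.val + 1 = 3 then (1 : L) else 0)).Local v),
      BorelSpace (((cmDatum L 3 (Matrix.of fun i j : Fin 3 => if i.val + j.val + 1 = 3 then (1 : L) else 0)).Local v) ⧸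
        Subgroup.centralizer ({γ} : Set ((cmDatum L 3 (Matrix.of fun i j : Fin 3 => if i.val + j.val + 1 = 3 then (1 : L) else 0)).Local v)))]
    [MeasurableSpace ((cmDatum L 2 (Matrix.of fun i j : Fin 2 => if i.val + j.val + 1 = 2 then (1 : L) else 0)).Local v ×
      (cmDatum L 1 (Matrix.of fun i j : Fin 1 => if i.val + j.val + 1 = 1 then (1 : L) else 0)).Local v)]
    [BorelSpace ((cmDatum L 2 (Matrix.of fun i j : Fin 2 => if i.val + j.val + 1 = 2 then (1 : L) else 0)).Local v ×
      (cmDatum L 1 (Matrix.of fun i j : Fin 1 => if i.val + j.val + 1 = 1 then (1 : L) else 0)).Local v)]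
    [∀ a : ((cmDatum L 2 (Matrix.of fun i j : Fin 2 => if i.val + j.val + 1 = 2 then (1 : L) else 0)).Local v ×
      (cmDatum L 1 (Matrix.of fun i j : Fin 1 => if i.val + j.val + 1 = 1 then (1 : L) else 0)).Local v),
      MeasurableSpace (((cmDatum L 2 (Matrix.of fun i j : Fin 2 => if i.val + j.val + 1 = 2 then (1 : L) else 0)).Local v ×
      (cmDatum L 1 (Matrix.of fun i j : Fin 1 => if i.val + j.val + 1 = 1 then (1 : L) else 0)).Local v) ⧸ Subgroup.centralizer ({a} : Set ((cmDatum L 2 (Matrix.of fun i j : Fin 2 => if i.val + j.val + 1 = 2 then (1 : L) else 0)).Local v ×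
      (cmDatum L 1 (Matrix.of fun i j : Fin 1 => if i.val + j.val + 1 = 1 then (1 : L) else 0)).Local v)))]
    [∀ a : ((cmDatum L 2 (Matrix.of fun i j : Fin 2 => if i.val + j.val + 1 = 2 then (1 : L) else 0)).Local v ×
      (cmDatum L 1 (Matrix.of fun i j : Fin 1 => if i.val + j.val + 1 = 1 then (1 : L) else 0)).Local v),
      BorelSpace (((cmDatum L 2 (Matrix.of fun i j : Fin 2 => if i.val + j.val + 1 = 2 then (1 : L) else 0)).Local v ×
      (cmDatum L 1 (Matrix.of fun i j : Fin 1 => if i.val + j.val + 1 = 1 then (1 : L) else 0)).Local v) ⧸ Subgroup.centralizer ({a} : Set ((cmDatum L 2 (Matrix.of fun i j : Fin 2 => if i.val + j.val + 1 = 2 then (1 : L) else 0)).Local v ×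
      (cmDatum L 1 (Matrix.of fun i j : Fin 1 => if i.val + j.val + 1 = 1 then (1 : L) else 0)).Local v)))]
    (νH : Measure ((cmDatum L 2 (Matrix.of fun i j : Fin 2 => if i.val + j.val + 1 = 2 then (1 : L) else 0)).Local v ×
      (cmDatum L 1 (Matrix.of fun i j : Fin 1 => if i.val + j.val + 1 = 1 then (1 : L) else 0)).Local v)) [νH.IsHaarMeasure] [νH.IsMulRightInvariant]
    (νG₃ : Measure ((cmDatum L 3 (Matrix.of fun i j : Fin 3 => if i.val + j.val + 1 = 3 then (1 : L) else 0)).Local v)) [νG₃.IsHaarMeasure] [νG₃.IsMulRightInvariant]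
    {mH : OrbitalMeasureFamily ((cmDatum L 2 (Matrix.of fun i j : Fin 2 => if i.val + j.val + 1 = 2 then (1 : L) else 0)).Local v ×
      (cmDatum L 1 (Matrix.of fun i j : Fin 1 => if i.val + j.val + 1 = 1 then (1 : L) else 0)).Local v)}
    {mG₃ : OrbitalMeasureFamily ((cmDatum L 3 (Matrix.of fun i j : Fin 3 => if i.val + j.val + 1 = 3 then (1 : L) else 0)).Local v)}
    (hmH : mH.IsCanonical (IsLocalGRegular L v) νH)
    (hmG : mG₃.IsCanonical (fun γ => IsRegularElt (γ.val : GL (Fin 3) (UnitaryGroup.LocalRing L v))) νG₃)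
    [MeasurableSpace ↥(unitaryGroupOfForm (conjLocal L (IsCMField.complexConj L) v) (cmLocalForm L 3 v))] [BorelSpace ↥(unitaryGroupOfForm (conjLocal L (IsCMField.complexConj L) v) (cmLocalForm L 3 v))]
    (μN : Measure ↥(unipotentU (conjLocal L (IsCMField.complexConj L) v) (cmLocalForm L 3 v))) [μN.IsHaarMeasure] [SFinite μN] :
    ∃ V ∈ 𝓝 (1 : ((cmDatum L 2 (Matrix.of fun i j : Fin 2 => if i.val + j.val + 1 = 2 then (1 : L) else 0)).Local v ×
        (cmDatum L 1 (Matrix.of fun i j : Fin 1 => if i.val + j.val + 1 = 1 then (1 : L) else 0)).Local v)),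
      ∀ γH ∈ V, IsLocalGRegular L v γH →
        (∃ (y : ((cmDatum L 2 (Matrix.of fun i j : Fin 2 => if i.val + j.val + 1 = 2 then (1 : L) else 0)).Local v ×
            (cmDatum L 1 (Matrix.of fun i j : Fin 1 => if i.val + j.val + 1 = 1 then (1 : L) else 0)).Local v)) (d' : Fin 2 → (UnitaryGroup.LocalRing L v)ˣ),
            glDiagonal 2 (UnitaryGroup.LocalRing L v) d' = ((y * γH * y⁻¹).1.val : GL (Fin 2) (UnitaryGroup.LocalRing L v))) →
        ∑ᶠ c : ConjClasses ((cmDatum L 3 (Matrix.of fun i j : Fin 3 => if i.val + j.val + 1 = 3 then (1 : L) else 0)).Local v),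
            ((finExplicitCollection L (Matrix.of fun i j : Fin 3 => if i.val + j.val + 1 = 3 then (1 : L) else 0) μ
              (finExplicitDelta_conj_left_all L (Matrix.of fun i j : Fin 3 => if i.val + j.val + 1 = 3 then (1 : L) else 0) μ)
              (finExplicitDelta_conj_right_all L (Matrix.of fun i j : Fin 3 => if i.val + j.val + 1 = 3 then (1 : L) else 0) μ)) v).Δ γH (Quotient.out c) *
            classOrbitalIntegral mG₃ (Set.indicator {u : ((cmDatum L 3 (Matrix.of fun i j : Fin 3 => if i.val + j.val + 1 = 3 then (1 : L) else 0)).Local v) |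
          u ∈ cmLocalIntegralLevel L 3 (Matrix.of fun i j : Fin 3 => if i.val + j.val + 1 = 3 then (1 : L) else 0) v ∧
          (InLevel ϖ a (wMatrix L w hw u - 1) ∧ InLevel ϖ b ((wMatrix L w hw u - 1) * (wMatrix L w hw u - 1)))} (fun _ => (1 : ℂ))) c =
          ((((Ideal.absNorm v.asIdeal : ℝ) ^ ((max (max a ((b + 1) / 2)) ((a + d) / 2) - d / 2) + (a - d % 2 + 1) / 2))⁻¹) : ℂ) *
          (((νG₃.real (cmLocalIntegralLevel L 3 (Matrix.of fun i j : Fin 3 => if i.val + j.val + 1 = 3 then (1 : L) else 0) v : Set ((cmDatum L 3 (Matrix.of fun i j : Fin 3 => if i.val + j.val + 1 = 3 then (1 : L) else 0)).Local v)) : ℂ) /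
            (νH.real ((((cmLocalIntegralLevel L 2 (Matrix.of fun i j : Fin 2 => if i.val + j.val + 1 = 2 then (1 : L) else 0) v).prod
              (cmLocalIntegralLevel L 1 (Matrix.of fun i j : Fin 1 => if i.val + j.val + 1 = 1 then (1 : L) else 0) v) : Subgroup _) : Set _)) : ℂ)) *
          stableOrbitalIntegralRel (IsLocalStablyConjH L v) mH (hFamily L w hw ϖ 0) γH) := by
  obtain ⟨hϖ0, hϖ1, hϖ1'⟩ := uniformizer_facts L w hϖ
  have hM1 : 1 ≤ mstarFn L v w := by
    rw [mstarFn_eq_of_isRamifiedQuadraticDatum L w hw he hD, mstarOfRecord]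
    have := hD.2.2.2.2.2.1; omega
  -- the two pieces and their invariances: `g := 𝟙_{K_{a,b}}` (★ p858704 ∕ ★ `indicator_profile_level_mul_eq`), `g′ := 1_K = gselStar 0` (★ `piecePropsWild_gselStar`)
  obtain ⟨hsm0, -, hK0, hM0⟩ := piecePropsWild_gselStar L w hw he h2 ϖ hϖ 0
  have hsm := (isLocSmooth_indicator_levels L w hw hϖ a b).1
  have hK : ∀ u ∈ cmLocalIntegralLevel L 3 (Matrix.of fun i j : Fin 3 => if i.val + j.val + 1 = 3 then (1 : L) else 0) v, ∀ x, Set.indicator {u : ((cmDatum L 3 (Matrix.of fun i j : Fin 3 => if i.val + j.val + 1 = 3 then (1 : L) else 0)).Local v) |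
          u ∈ cmLocalIntegralLevel L 3 (Matrix.of fun i j : Fin 3 => if i.val + j.val + 1 = 3 then (1 : L) else 0) v ∧
          (InLevel ϖ a (wMatrix L w hw u - 1) ∧ InLevel ϖ b ((wMatrix L w hw u - 1) * (wMatrix L w hw u - 1)))} (fun _ => (1 : ℂ)) (u * x * u⁻¹) = Set.indicator {u : ((cmDatum L 3 (Matrix.of fun i j : Fin 3 => if i.val + j.val + 1 = 3 then (1 : L) else 0)).Local v) |
          u ∈ cmLocalIntegralLevel L 3 (Matrix.of fun i j : Fin 3 => if i.val + j.val + 1 = 3 then (1 : L) else 0) v ∧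
          (InLevel ϖ a (wMatrix L w hw u - 1) ∧ InLevel ϖ b ((wMatrix L w hw u - 1) * (wMatrix L w hw u - 1)))} (fun _ => (1 : ℂ)) x :=
    fun u hu x => indicator_levels_conj_eq L w hw hϖ a b hu x
  have hM : ∀ u : ((cmDatum L 3 (Matrix.of fun i j : Fin 3 => if i.val + j.val + 1 = 3 then (1 : L) else 0)).Local v),
      (∀ i j, Valued.v ((ϖ ^ (mstarFn L v w))⁻¹ * ((((localNonsplitEquiv (IsCMField.complexConj L) (Matrix.of fun i j : Fin 3 => if i.val + j.val + 1 = 3 then (1 : L) else 0) (IsCMField.complexConj_ne_one L) w hw u :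
            ↥(unitaryGroupOfForm (galAdicCompletionMap (L := L) (IsCMField.complexConj L) hw) (placeForm (Matrix.of fun i j : Fin 3 => if i.val + j.val + 1 = 3 then (1 : L) else 0) w.1))) : GL (Fin 3) (w.1.adicCompletion L)) :
              Matrix (Fin 3) (Fin 3) (w.1.adicCompletion L)) i j - (1 : Matrix (Fin 3) (Fin 3) (w.1.adicCompletion L)) i j)) ≤ 1) →
      ∀ x, Set.indicator {u : ((cmDatum L 3 (Matrix.of fun i j : Fin 3 => if i.val + j.val + 1 = 3 then (1 : L) else 0)).Local v) |
          u ∈ cmLocalIntegralLevel L 3 (Matrix.of fun i j : Fin 3 => if i.val + j.val + 1 = 3 then (1 : L) else 0) v ∧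
          (InLevel ϖ a (wMatrix L w hw u - 1) ∧ InLevel ϖ b ((wMatrix L w hw u - 1) * (wMatrix L w hw u - 1)))} (fun _ => (1 : ℂ)) (u * x) = Set.indicator {u : ((cmDatum L 3 (Matrix.of fun i j : Fin 3 => if i.val + j.val + 1 = 3 then (1 : L) else 0)).Local v) |
          u ∈ cmLocalIntegralLevel L 3 (Matrix.of fun i j : Fin 3 => if i.val + j.val + 1 = 3 then (1 : L) else 0) v ∧
          (InLevel ϖ a (wMatrix L w hw u - 1) ∧ InLevel ϖ b ((wMatrix L w hw u - 1) * (wMatrix L w hw u - 1)))} (fun _ => (1 : ℂ)) x := by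
    intro u hu x
    have hU : IsIntMatrix ((ϖ ^ (mstarFn L v w))⁻¹ • ((((localNonsplitEquiv (IsCMField.complexConj L) (Matrix.of fun i j : Fin 3 => if i.val + j.val + 1 = 3 then (1 : L) else 0) (IsCMField.complexConj_ne_one L) w hw u :
            ↥(unitaryGroupOfForm (galAdicCompletionMap (L := L) (IsCMField.complexConj L) hw) (placeForm (Matrix.of fun i j : Fin 3 => if i.val + j.val + 1 = 3 then (1 : L) else 0) w.1))) : GL (Fin 3) (w.1.adicCompletion L)) :
              Matrix (Fin 3) (Fin 3) (w.1.adicCompletion L)) - 1)) := fun i j => by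
      rw [Matrix.smul_apply, smul_eq_mul, Matrix.sub_apply]; exact hu i j
    have h := indicator_profile_level_mul_eq L w hw (fun X => InLevel ϖ a X ∧ InLevel ϖ b (X * X)) hϖ0 hϖ1 hM1
      (fun X D hX hDl => and_congr (inLevel_add_iff_of_inLevel hϖ0 hϖ1' ha hDl) (inLevel_mul_self_add_iff hϖ0 hϖ1' hb hX hDl)) u hU x
    simpa only [wMatrix] using h
  -- ★ p858898: near 1, `(Σᶠ Δ‴·Φ(g))·∫ g′ = (Σᶠ Δ‴·Φ(g′))·∫ g` (T := the explicit collection)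
  obtain ⟨V₁, hV₁, h1⟩ := exists_nhds_one_finsum_delta_mul_integral_eq_of_levi_of_level L w hw ϖ hϖ (mstarFn L v w) νG₃ hmG μN
    ((finExplicitCollection L (Matrix.of fun i j : Fin 3 => if i.val + j.val + 1 = 3 then (1 : L) else 0) μ (finExplicitDelta_conj_left_all L (Matrix.of fun i j : Fin 3 => if i.val + j.val + 1 = 3 then (1 : L) else 0) μ) (finExplicitDelta_conj_right_all L (Matrix.of fun i j : Fin 3 => if i.val + j.val + 1 = 3 then (1 : L) else 0) μ)) v)
    hsm.continuous.measurable hsm0.continuous.measurable hK hK0 hM hM0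
  -- ★ p855650 at the root vertex: the anchor's row (3)
  have hN : IsVertexLattice (galAdicCompletionMap (L := L) (IsCMField.complexConj L) hw) ϖ ((StdForm.antidiagonal 3).over (w.1.adicCompletion L)) 0
      (stdLattice (w.1.adicCompletion L) 3) :=
    isSelfDualLattice_stdLattice_three_of_v hϖ
  have hKt : ∀ u : ((cmDatum L 3 (Matrix.of fun i j : Fin 3 => if i.val + j.val + 1 = 3 then (1 : L) else 0)).Local v),
      u ∈ cmLocalIntegralLevel L 3 (Matrix.of fun i j : Fin 3 => if i.val + j.val + 1 = 3 then (1 : L) else 0) v ↔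
        mapGL ((localNonsplitEquiv (IsCMField.complexConj L) (Matrix.of fun i j : Fin 3 => if i.val + j.val + 1 = 3 then (1 : L) else 0) (IsCMField.complexConj_ne_one L) w hw u :
          ↥(unitaryGroupOfForm (galAdicCompletionMap (L := L) (IsCMField.complexConj L) hw) (placeForm (Matrix.of fun i j : Fin 3 => if i.val + j.val + 1 = 3 then (1 : L) else 0) w.1))) : GL (Fin 3) (w.1.adicCompletion L))
          (stdLattice (w.1.adicCompletion L) 3) = stdLattice (w.1.adicCompletion L) 3 :=
    fun u => (mem_localIntegralLevel_iff_of_smul_eq (IsCMField.complexConj L) 3 (Matrix.of fun i j : Fin 3 => if i.val + j.val + 1 = 3 then (1 : L) else 0) (IsCMField.complexConj_ne_one L) w hw u).trans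
      (mapGL_stdLattice_eq_iff_mem_glInt _).symm
  obtain ⟨V₀, hV₀, h0⟩ := exists_nhds_one_finsum_delta_indicator_eq_mul_stableOrbitalIntegralRel_hFamily_zero_of_levi L w hw he ϖ hϖ μ hμω νH νG₃ hmH hmG hN
    (cmLocalIntegralLevel L 3 (Matrix.of fun i j : Fin 3 => if i.val + j.val + 1 = 3 then (1 : L) else 0) v) hKt
  refine ⟨V₀ ∩ V₁, inter_mem hV₀ hV₁, fun γH hγ hreg hlevi => ?_⟩
  have e0 := h0 γH hγ.1 hreg hlevi
  have e1 := h1 γH hγ.2 hlevi hreg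
  have hg0 : (gselStar 0) L v w hw ϖ = Set.indicator (cmLocalIntegralLevel L 3 (Matrix.of fun i j : Fin 3 => if i.val + j.val + 1 = 3 then (1 : L) else 0) v : Set ((cmDatum L 3 (Matrix.of fun i j : Fin 3 => if i.val + j.val + 1 = 3 then (1 : L) else 0)).Local v)) (fun _ => (1 : ℂ)) := rfl
  rw [integral_gselStar_zero_eq_measureReal L w hw ϖ μN, integral_indicator_levels_eq L w hw ϖ hϖ a b μN, hg0, e0,
    measureReal_setOf_mem_and_levels_eq L v w hw μN he hD a b] at e1
  -- cancel the non-zero mass `μ_N.real{n ∈ K}`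
  have hK0' : ((μN.real {n : ↥(unipotentU (conjLocal L (IsCMField.complexConj L) v) (cmLocalForm L 3 v)) | ((n : ↥(unitaryGroupOfForm (conjLocal L (IsCMField.complexConj L) v) (cmLocalForm L 3 v))) : ((cmDatum L 3 (Matrix.of fun i j : Fin 3 => if i.val + j.val + 1 = 3 then (1 : L) else 0)).Local v)) ∈ cmLocalIntegralLevel L 3 (Matrix.of fun i j : Fin 3 => if i.val + j.val + 1 = 3 then (1 : L) else 0) v} : ℝ) : ℂ) ≠ 0 := by
    rw [Ne, Complex.ofReal_eq_zero]; exact measureReal_setOf_mem_cmLocalIntegralLevel_ne_zero L μN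
  apply mul_right_cancel₀ hK0'
  rw [e1]
  push_cast
  ring

end Summit.HodgeConjecture.HodgeConjecture.Cruxes.H413.F0P3cDyRamLevelsLeviRow

end
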